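import Summits.QuantumFields.YangMills.Theorems.BalabanUVNodesN08Thm2AtRecordTransplant
import Summits.QuantumFields.YangMills.Theorems.BalabanUVNodesN08Thm2AtRecordWindowCeiling
import Summits.QuantumFields.Balaban3D.Proofs.FamilyLE

/-!
# BalabanUVNodes ∕ N08 — [Balaban1985UV3] Thm 2 (and Thm 1, compact reading) AT THE RECORD'S BINDERS FROM THE d = 3 LANE'S (α) INPUTS, in print's regime:
# the record's per-run datum, its Thm-2 conjunct, the printed pair `PrintedUV3G` and the PRIMED SLOT `Node00.PrintedUV3V'` from `UVStability3DInputs.RunAlpha`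
# on the lane's external inputs pinned to the record above level 0 — NO `εbg > 2`, only file 8's window (e.g. file 5's coupling ceiling)

Track A, DAG node N08 = T. Bałaban, CMP **102** (1985) 255–275 [Balaban1985UV3]: Thm 1 p. 257, Thm 2 p. 272, (1)–(7) pp. 256–257, (41)–(43) p. 266, (47) p. 267, the step
leaves (22)–(36) pp. 261–265 ∕ (55)–(62) pp. 269–272, (67)–(68) p. 273, p. 259 L1 «For g₀ sufficiently small»; [7] = [Balaban1985Variational] (2) p. 278.  Cell `pub-ymgap`,
width seat `pub-ymgap-dag-n08-w1` (g2), W-SEAT-START-LIST §n08 item 1 successor piece (o5) = file 13; `--supports` K1⁷ `StabilityBAtRecordR13SepCoPH` (helper).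
Companion of `…N08Thm2AtRecordTransplant` (file 11: leaf systems on the lane's towers pinned to the record above level 0 TRANSPLANT to the record's binders under the window)
and of n08-a's `…N08Constructed` (the lane's constructed towers carry `ConcreteLeaves` as soon as the (α) inputs hold: `Residuals.analyticLeavesOf ∘ FamilyLE.runResiduals_of_alpha_le`,
`EndTheorem.carrierEqs_pin ∘ Inputs.usesConsts_inputOf` — there knitted at the C-binding over the CONSTRUCTED family; here at the RECORD'S binders).

WHAT THIS FILE PROVES (kernel; theorems only, 0 def; nothing of the paper asserted).  For the lane's external inputs `X S : Carriers.ExternalInputs S (SU N)` (Haar-compatible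
averaging — n08-a's seam E6′ is about inhabiting these at print's averaging; not touched here) whose [7]-minimisers above level 0 are the record's (`(X S).U_k = UkA … (k+1) εbg`
along `𝔞_X`), expansion data `𝔖`, (α) data `𝔄`, and the constants `c⋆ = (eps0Of γ₀, Σ_{j<K}E^{(j)}, lane b₀, p₀, εbg)`:
* §1 ★★ `repr41_47G_at_record_of_runAlpha_of_window` — on one member of the `≤`-family `g²ε₀ ≤ (min γ₀ 1)²`, **`RunAlpha` + the level-0 window `ε₁(0)(S) ≤ εbg ∨ 2 < εbg`
  ⇒ the record's per-run datum `Repr41_47G N (runObjects₀A N 𝔞_X 𝔗_X (Backgrounds.ofAvg N L 𝔞_X)) c⋆ S k` for every `k ≤ K`** (file 11's transplant of the lane's concrete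
  leaf bundle); `…_of_ceiling`: in print's regime `γ₀ ≤ e^{1−p₀}`, `γ₀p(γ₀) ≤ εbg` the window holds at every member (file 5).
* §2 ★★ `thm2Printed_at_record_of_runAlpha_of_ceiling` — **THE RECORD'S Thm-2 CONJUNCT `B10.Thm2Printed (runsAtG N (runObjects₀A …) c⋆)`** from `RunAlpha` at every member of
  `Family L c⋆.eps0`, in print's regime; `consts_adm_of_pos` — `c⋆` is admissible for `εbg > 0`.
* §3 ★★★ `printedUV3G_at_record_of_runAlpha_of_ceiling` ∕ `printedUV3V'_at_record_of_runAlpha_of_ceiling` — **THE PRINTED PAIR (Thm 1 compact ∧ Thm 2, ∃-prefix) AT THE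
  RECORD'S BINDERS along `𝔞_X`, and — if `𝔞_X` is admissible in print's sense (`Node00.AvgAdmissible₃`) — THE PRIMED SLOT `Node00.PrintedUV3V' N L`, FROM THE LANE'S (α) INPUTS
  in print's regime** (one `C = 𝔠.lane.consts` for the family: Thm 1's «O(1) independent of ε, k»).  With `𝔞_X =` print's own averaging this is the unprimed slot
  (`printedUV3V_at_record_of_runAlpha_of_ceiling`; such inputs are n08-a∕n08-w3's E6′ matter).
* §4 ★★★ `printedUV3V_of_E6'_of_runAlpha_of_ceiling` — **THE SLOT OF RECORD FROM THE TWO NAMED RESIDUALS**: E6′ (exact Haar compatibility of print's averaging, every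
  member and level) gives external inputs at print's averaging pinned to the record (A6 for §3's `hav`); with the (α) inputs over them and print's regime,
  `Node00.PrintedUV3V N L`.

HONEST FRAMING: count-neutral helper; N08 NOT discharged — the (α) INPUTS `RunAlpha` (the GAP binders G3D-01…08 «as cited», the displays (26), (28), (44), (67), (68), the residual
rows, at the lane's constructed objects) are HYPOTHESES whose joint satisfiability at inputs pinned to the record is the lane's open programme = N08's object gap (class II of n08-b's
census); `PrintedUV3V'` ∕ `PrintedUV3V` NOT proved; one finite 𝕋⁴ programme at fixed ε, Bałaban AS PRINTED (d = 3 tori of [B10] inside the record) — R4 closes the conditional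
finite-𝕋⁴ rung `BalabanLadder.UV` only; the Yang–Mills mass gap (Clay) is NOT proved by any of this; nothing continuum ∕ ℝ⁴ ∕ OS.  No `sorry`, standard axioms.
-/

noncomputable section

namespace Summit.QuantumFields.YangMills.BalabanUVNodes.N08Thm2AtRecordFromAlpha

open Literature.MathematicalPhysics.QuantumFieldTheory.Balaban1983to89
open Literature.MathematicalPhysics.QuantumFieldTheory.Balaban1983to89.Node00 (SU TFamily₃)
open Literature.MathematicalPhysics.QuantumFieldTheory.Balaban1983to89.B10RunsOfRecord
open Literature.MathematicalPhysics.QuantumFieldTheory.Balaban1985CMP102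
open Literature.MathematicalPhysics.QuantumFieldTheory.Balaban1985CMP102.Setting
open Literature.MathematicalPhysics.QuantumFieldTheory.Balaban1985CMP102.Theorems (Family)
open Summit.QuantumFields.Balaban3D
open Summit.QuantumFields.Balaban3D.Carriers (nblkOf StepSeries ExternalInputs)
open Summit.QuantumFields.Balaban3D.Proofs
open Summit.QuantumFields.Balaban3D.Proofs.GroupModelLieC (lieC)
open Summit.QuantumFields.Balaban3D.Proofs.Constants (eps0Of)
open Summit.QuantumFields.Balaban3D.Proofs.Inputs (inputOf towerOf usesConsts_inputOf)
open Summit.QuantumFields.Balaban3D.Proofs.Residuals (analyticLeavesOf)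
open Summit.QuantumFields.Balaban3D.Proofs.UVStability3DInputs (AlphaData RunAlpha)
open Summit.QuantumFields.Balaban3D.Proofs.FamilyLE (le_of_eps0Of runResiduals_of_alpha_le)
open Summit.QuantumFields.YangMills.BalabanUVNodes.N08Thm2AtRecordLevelZero
open Summit.QuantumFields.YangMills.BalabanUVNodes.N08Thm2AtRecordWindowCeiling
open Summit.QuantumFields.YangMills.BalabanUVNodes.N08Thm2AtRecordTransplant

variable {N : ℕ} [NeZero N] {L : ℕ} {𝔊 : GroupModel (SU N)} {𝔠 : Primitives.AlphaConsts L 𝔊.N} {εbg : ℝ}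
  {X : ∀ S : Scales L, ExternalInputs S (SU N)}
  {𝔖 : ∀ (S : Scales L) (k : ℕ), StepSeries S (SU N) ↥(lieC 𝔊) (nblkOf S 𝔠.lane.carrier k) k}
  {𝔄 : ∀ S : Scales L, AlphaData 𝔊 𝔠 (X S) (𝔖 S)}

/-! ## §1 The record's per-run datum from the (α) inputs, given the window -/
section PerRun

/-- ★★ **THE RECORD'S PER-RUN DATUM FROM THE LANE'S (α) INPUTS, GIVEN THE LEVEL-0 WINDOW** (one member of the `≤`-family; the lane's external inputs with the record's
minimisers above level 0; any `εbg`): `RunAlpha` ⇒ the lane's concrete leaf bundle on `towerOf 𝔠.lane (X S) (𝔖 S)` (n08-a∕lane: `analyticLeavesOf ∘ runResiduals_of_alpha_le`,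
`carrierEqs_pin ∘ usesConsts_inputOf`, `leafSystem_of_concrete`) ⇒ (file 11's transplant) `Repr41_47G N (runObjects₀A N 𝔞_X 𝔗_X (Backgrounds.ofAvg N L 𝔞_X)) c⋆ S k`, `k ≤ K`.
[cite: Balaban1985UV3, Thm 2 p.272 + pp.256–274 (the leaves) + (47) p.267 + (7) p.257] -/
theorem repr41_47G_at_record_of_runAlpha_of_window
    (hUk : ∀ (S : Scales L) k (V : GaugeField S.P (k + 1) (SU N)), (X S).Uk k V = UkA N (fun S => (X S).av) S (k + 1) εbg V)
    {S : Scales L} (hle : S.g ^ 2 * S.ε₀ ≤ (min 𝔠.gamma0 1) ^ 2) (R : RunAlpha 𝔊 𝔠 (X S) (𝔖 S) (𝔄 S))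
    (hwin : eps1OfPrint
        { eps0 := eps0Of 𝔠.gamma0, E := fun S => B10.Ek (inputOf 𝔠.lane (X S) (𝔖 S)).Estep S.K 0,
          b₀ := 𝔠.lane.F.b₀, p₀ := 𝔠.lane.F.p₀, εbg := εbg } S 0 ≤ εbg ∨ 2 < εbg)
    (k : ℕ) (hk : k ≤ S.K) :
    Repr41_47G N (runObjects₀A N (fun S => (X S).av) (fun S j => (Carriers.run3 ((inputOf 𝔠.lane (X S) (𝔖 S)).toRunInput fun _ => True)).T j)
        (Backgrounds.ofAvg N L fun S => (X S).av))
      { eps0 := eps0Of 𝔠.gamma0, E := fun S => B10.Ek (inputOf 𝔠.lane (X S) (𝔖 S)).Estep S.K 0,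
        b₀ := 𝔠.lane.F.b₀, p₀ := 𝔠.lane.F.p₀, εbg := εbg } S k :=
  repr41_47G_of_leafSystem_tower3_of_window (fun S => inputOf 𝔠.lane (X S) (𝔖 S))
    { eps0 := eps0Of 𝔠.gamma0, E := fun S => B10.Ek (inputOf 𝔠.lane (X S) (𝔖 S)).Estep S.K 0,
      b₀ := 𝔠.lane.F.b₀, p₀ := 𝔠.lane.F.p₀, εbg := εbg }
    (fun _ _ => rfl) (fun S k V => hUk S k V) (fun _ => rfl) hwin
    (UVStability3D.leafSystem_of_concrete 𝔠.lane.normalised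
      ⟨EndTheorem.carrierEqs_pin _ (usesConsts_inputOf 𝔠.lane (X S) (𝔖 S) fun _ => True), analyticLeavesOf (runResiduals_of_alpha_le hle R)⟩) k hk

/-- **The window from print's regime** (file 5): a lane threshold `γ₀ ≤ e^{1−p₀}` with `γ₀·p(γ₀) ≤ εbg` gives `ε₁(0)(S) ≤ εbg` at every member of the `≤`-family.
[cite: Balaban1985UV3, (7) p.257 + p.259 L1] -/
theorem window_of_ceiling_le (hγ : 𝔠.gamma0 ≤ Real.exp (1 - 𝔠.lane.F.p₀)) (hε : 𝔠.gamma0 * B10.pFun 𝔠.lane.F.b₀ 𝔠.lane.F.p₀ 𝔠.gamma0 ≤ εbg)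
    (E : Scales L → ℝ) {S : Scales L} (hle : S.g ^ 2 * S.ε₀ ≤ (min 𝔠.gamma0 1) ^ 2) :
    eps1OfPrint ({ eps0 := eps0Of 𝔠.gamma0, E := E, b₀ := 𝔠.lane.F.b₀, p₀ := 𝔠.lane.F.p₀, εbg := εbg } : Consts L) S 0 ≤ εbg ∨ 2 < εbg :=
  Or.inl ((eps1OfPrint_zero_le_of_ceiling
      ({ eps0 := eps0Of 𝔠.gamma0, E := E, b₀ := 𝔠.lane.F.b₀, p₀ := 𝔠.lane.F.p₀, εbg := εbg } : Consts L)
      𝔠.lane.F.b₀_pos.le (by linarith [𝔠.lane.F.two_lt_p₀]) S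
      (FamilyLE.gk_le_gamma0_of_le S 𝔠.gamma0_pos.le hle 0 (Nat.zero_le _)) hγ).trans hε)

/-- ★★ **… IN PRINT'S REGIME** (`γ₀ ≤ e^{1−p₀}`, `γ₀p(γ₀) ≤ εbg`): `RunAlpha` on a member of the `≤`-family ⇒ the record's per-run datum at `c⋆` for every `k ≤ K`.
[cite: Balaban1985UV3, Thm 2 p.272 + (7) p.257 + p.259 L1] -/
theorem repr41_47G_at_record_of_runAlpha_of_ceiling
    (hUk : ∀ (S : Scales L) k (V : GaugeField S.P (k + 1) (SU N)), (X S).Uk k V = UkA N (fun S => (X S).av) S (k + 1) εbg V)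
    (hγ : 𝔠.gamma0 ≤ Real.exp (1 - 𝔠.lane.F.p₀)) (hε : 𝔠.gamma0 * B10.pFun 𝔠.lane.F.b₀ 𝔠.lane.F.p₀ 𝔠.gamma0 ≤ εbg)
    {S : Scales L} (hle : S.g ^ 2 * S.ε₀ ≤ (min 𝔠.gamma0 1) ^ 2) (R : RunAlpha 𝔊 𝔠 (X S) (𝔖 S) (𝔄 S)) (k : ℕ) (hk : k ≤ S.K) :
    Repr41_47G N (runObjects₀A N (fun S => (X S).av) (fun S j => (Carriers.run3 ((inputOf 𝔠.lane (X S) (𝔖 S)).toRunInput fun _ => True)).T j)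
        (Backgrounds.ofAvg N L fun S => (X S).av))
      { eps0 := eps0Of 𝔠.gamma0, E := fun S => B10.Ek (inputOf 𝔠.lane (X S) (𝔖 S)).Estep S.K 0,
        b₀ := 𝔠.lane.F.b₀, p₀ := 𝔠.lane.F.p₀, εbg := εbg } S k :=
  repr41_47G_at_record_of_runAlpha_of_window (𝔄 := 𝔄) hUk hle R (window_of_ceiling_le hγ hε _ hle) k hk

end PerRun

/-! ## §2 The record's Thm-2 conjunct on the family, from the (α) inputs in print's regime -/
section Conjunct

/-- Admissibility of `c⋆` for ANY `εbg > 0` (file 4's `constsAC_adm` asked `εbg > 2`): `ε₀(g) = (min γ₀ 1)²/g² > 0` with `g²ε₀ ≤ 1`, the lane's `b₀ > 0`, `p₀ > 2`.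
[cite: Balaban1985UV3, p.256 L15–18 + (7) p.257] -/
theorem consts_adm_of_pos (𝔠 : Primitives.AlphaConsts L 𝔊.N) {εbg : ℝ} (hε : 0 < εbg) (E : Scales L → ℝ) :
    ({ eps0 := eps0Of 𝔠.gamma0, E := E, b₀ := 𝔠.lane.F.b₀, p₀ := 𝔠.lane.F.p₀, εbg := εbg } : Consts L).Adm := by
  refine ⟨fun g hg => ⟨?_, ?_⟩, 𝔠.lane.F.b₀_pos, 𝔠.lane.F.two_lt_p₀, hε⟩
  · show 0 < eps0Of 𝔠.gamma0 g
    unfold eps0Of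
    have h1 : 0 < min 𝔠.gamma0 1 := lt_min 𝔠.gamma0_pos one_pos
    positivity
  · show g ^ 2 * eps0Of 𝔠.gamma0 g ≤ 1
    unfold eps0Of
    rw [mul_div_assoc', mul_div_cancel_left₀ _ (pow_ne_zero 2 hg.ne')]
    have h1 : min 𝔠.gamma0 1 ≤ 1 := min_le_right _ _
    have h0 : 0 ≤ min 𝔠.gamma0 1 := (lt_min 𝔠.gamma0_pos one_pos).le
    nlinarith

/-- ★★ **THE RECORD'S Thm-2 CONJUNCT AT THE BINDERS ALONG `𝔞_X`, FROM THE LANE'S (α) INPUTS IN PRINT'S REGIME**: `RunAlpha` at every member of `Family L c⋆.eps0`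
(`c⋆.eps0 = eps0Of γ₀`, so every member lies on the `≤`-family), `γ₀ ≤ e^{1−p₀}`, `γ₀p(γ₀) ≤ εbg` ⇒ `B10.Thm2Printed (runsAtG N (runObjects₀A N 𝔞_X 𝔗_X (Backgrounds.ofAvg N L 𝔞_X)) c⋆)`
— the ∃-representation reading «ρ_k satisfies (41), (47)» at every member and every `k ≤ K`, for the record's binders' densities. [cite: Balaban1985UV3, Thm 2 p.272 + p.256 L15–18] -/
theorem thm2Printed_at_record_of_runAlpha_of_ceiling
    (hUk : ∀ (S : Scales L) k (V : GaugeField S.P (k + 1) (SU N)), (X S).Uk k V = UkA N (fun S => (X S).av) S (k + 1) εbg V)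
    (hγ : 𝔠.gamma0 ≤ Real.exp (1 - 𝔠.lane.F.p₀)) (hε : 𝔠.gamma0 * B10.pFun 𝔠.lane.F.b₀ 𝔠.lane.F.p₀ 𝔠.gamma0 ≤ εbg)
    (R : ∀ S : Family L (eps0Of 𝔠.gamma0), RunAlpha 𝔊 𝔠 (X S.1) (𝔖 S.1) (𝔄 S.1)) :
    B10.Thm2Printed (runsAtG N (runObjects₀A N (fun S => (X S).av)
        (fun S j => (Carriers.run3 ((inputOf 𝔠.lane (X S) (𝔖 S)).toRunInput fun _ => True)).T j) (Backgrounds.ofAvg N L fun S => (X S).av))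
      { eps0 := eps0Of 𝔠.gamma0, E := fun S => B10.Ek (inputOf 𝔠.lane (X S) (𝔖 S)).Estep S.K 0,
        b₀ := 𝔠.lane.F.b₀, p₀ := 𝔠.lane.F.p₀, εbg := εbg }) := by
  intro S k hk
  exact repr41_47G_at_record_of_runAlpha_of_ceiling (𝔄 := 𝔄) hUk hγ hε (le_of_eps0Of S.1 S.2) (R S) k hk

end Conjunct

/-! ## §3 The printed pair at the record's binders and the primed slot, from the (α) inputs in print's regime -/
section Slot

/-- ★★★ **THE PRINTED PAIR `PrintedUV3G` — [B10] Thm 1 (compact reading) ∧ Thm 2 WITH THEIR ∃-PREFIX — AT THE RECORD'S BINDERS ALONG `𝔞_X`, FROM THE LANE'S (α) INPUTS IN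
PRINT'S REGIME** (`RunAlpha` at every member of `Family L c⋆.eps0`; `γ₀ ≤ e^{1−p₀}`, `0 < γ₀p(γ₀) ≤ εbg`; ONE leaf-constants record `𝔠.lane.consts` for the family = Thm 1's
«O(1) independent of ε, k»): file 11's `printedUV3G_of_analyticLeaves_tower3_of_window` at the lane's concrete leaf bundles. [cite: Balaban1985UV3, Thm 1 p.257 + Thm 2 p.272 + pp.256–274] -/
theorem printedUV3G_at_record_of_runAlpha_of_ceiling (hpos : 0 < εbg)
    (hUk : ∀ (S : Scales L) k (V : GaugeField S.P (k + 1) (SU N)), (X S).Uk k V = UkA N (fun S => (X S).av) S (k + 1) εbg V)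
    (hγ : 𝔠.gamma0 ≤ Real.exp (1 - 𝔠.lane.F.p₀)) (hε : 𝔠.gamma0 * B10.pFun 𝔠.lane.F.b₀ 𝔠.lane.F.p₀ 𝔠.gamma0 ≤ εbg)
    (R : ∀ S : Family L (eps0Of 𝔠.gamma0), RunAlpha 𝔊 𝔠 (X S.1) (𝔖 S.1) (𝔄 S.1)) :
    PrintedUV3G N L (runObjects₀A N (fun S => (X S).av)
        (fun S j => (Carriers.run3 ((inputOf 𝔠.lane (X S) (𝔖 S)).toRunInput fun _ => True)).T j) (Backgrounds.ofAvg N L fun S => (X S).av)) :=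
  printedUV3G_of_analyticLeaves_tower3_of_window (fun S => inputOf 𝔠.lane (X S) (𝔖 S))
    { eps0 := eps0Of 𝔠.gamma0, E := fun S => B10.Ek (inputOf 𝔠.lane (X S) (𝔖 S)).Estep S.K 0,
      b₀ := 𝔠.lane.F.b₀, p₀ := 𝔠.lane.F.p₀, εbg := εbg }
    (consts_adm_of_pos 𝔠 hpos _) (fun _ _ => rfl) (fun S k V => hUk S k V) (fun _ => rfl)
    (fun S => window_of_ceiling_le hγ hε _ (le_of_eps0Of S.1 S.2)) 𝔠.lane.normalised
    (fun S => usesConsts_inputOf 𝔠.lane (X S.1) (𝔖 S.1) fun _ => True)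
    (fun S => analyticLeavesOf (runResiduals_of_alpha_le (le_of_eps0Of S.1 S.2) (R S)))

/-- ★★★ **THE PRIMED SLOT `Node00.PrintedUV3V' N L` FROM THE LANE'S (α) INPUTS IN PRINT'S REGIME**, along an averaging family that is ADMISSIBLE in print's sense
(`Node00.AvgAdmissible₃ N 𝔞_X`; chair R451 (R-b)).  The (α) inputs are the hypothesis = N08's object gap; the admissibility of the lane's averaging is a displayed
binder. [cite: Balaban1985UV3, Thm 1 p.257 + Thm 2 p.272; Balaban1985Averaging, (14)–(15) p.19] -/
theorem printedUV3V'_at_record_of_runAlpha_of_ceiling (h𝔞 : Node00.AvgAdmissible₃ N fun S => (X S).av) (hpos : 0 < εbg)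
    (hUk : ∀ (S : Scales L) k (V : GaugeField S.P (k + 1) (SU N)), (X S).Uk k V = UkA N (fun S => (X S).av) S (k + 1) εbg V)
    (hγ : 𝔠.gamma0 ≤ Real.exp (1 - 𝔠.lane.F.p₀)) (hε : 𝔠.gamma0 * B10.pFun 𝔠.lane.F.b₀ 𝔠.lane.F.p₀ 𝔠.gamma0 ≤ εbg)
    (R : ∀ S : Family L (eps0Of 𝔠.gamma0), RunAlpha 𝔊 𝔠 (X S.1) (𝔖 S.1) (𝔄 S.1)) : Node00.PrintedUV3V' N L :=
  ⟨fun S => (X S).av, h𝔞, fun S j => (Carriers.run3 ((inputOf 𝔠.lane (X S) (𝔖 S)).toRunInput fun _ => True)).T j,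
    printedUV3G_at_record_of_runAlpha_of_ceiling (𝔄 := 𝔄) hpos hUk hγ hε R⟩

/-- ★★ **… and THE SLOT OF RECORD `Node00.PrintedUV3V N L` ITSELF when the lane's external inputs average by PRINT'S OWN (15)** (`(X S).av = avOfPrint N S` — the E6′ matter
of n08-a ∕ n08-w3: print's averaging as a Haar-compatible `ExternalInputs`; a displayed binder here): file 11's `printedUV3V_of_analyticLeaves_tower3_of_window`.
[cite: Balaban1985UV3, Thm 1 p.257 + Thm 2 p.272; Balaban1985Averaging, (15) p.19] -/
theorem printedUV3V_at_record_of_runAlpha_of_ceiling (hav : ∀ S, (X S).av = avOfPrint N S) (hpos : 0 < εbg)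
    (hUk : ∀ (S : Scales L) k (V : GaugeField S.P (k + 1) (SU N)), (X S).Uk k V = UkA N (fun S => (X S).av) S (k + 1) εbg V)
    (hγ : 𝔠.gamma0 ≤ Real.exp (1 - 𝔠.lane.F.p₀)) (hε : 𝔠.gamma0 * B10.pFun 𝔠.lane.F.b₀ 𝔠.lane.F.p₀ 𝔠.gamma0 ≤ εbg)
    (R : ∀ S : Family L (eps0Of 𝔠.gamma0), RunAlpha 𝔊 𝔠 (X S.1) (𝔖 S.1) (𝔄 S.1)) : Node00.PrintedUV3V N L :=
  printedUV3V_of_analyticLeaves_tower3_of_window (fun S => inputOf 𝔠.lane (X S) (𝔖 S)) hav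
    { eps0 := eps0Of 𝔠.gamma0, E := fun S => B10.Ek (inputOf 𝔠.lane (X S) (𝔖 S)).Estep S.K 0,
      b₀ := 𝔠.lane.F.b₀, p₀ := 𝔠.lane.F.p₀, εbg := εbg }
    (consts_adm_of_pos 𝔠 hpos _) (fun _ _ => rfl) (fun S k V => hUk S k V) (fun _ => rfl)
    (fun S => window_of_ceiling_le hγ hε _ (le_of_eps0Of S.1 S.2)) 𝔠.lane.normalised
    (fun S => usesConsts_inputOf 𝔠.lane (X S.1) (𝔖 S.1) fun _ => True)
    (fun S => analyticLeavesOf (runResiduals_of_alpha_le (le_of_eps0Of S.1 S.2) (R S)))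

end Slot

/-! ## §4 The slot of record from the two named residuals: E6′ (exact Haar compatibility of print's averaging) and the (α) inputs at print's objects -/
section TwoResiduals

variable (N L)

/-- **THE SLOT OF RECORD `Node00.PrintedUV3V N L` FROM TWO NAMED RESIDUALS, in print's regime.**  IF print's averaging (15) is EXACTLY Haar compatible at every
member and level (E6′ — n08-a's seam, `B10Eq2HaarCompatibility`; holds beyond the standing range, undecided inside it at `N ≥ 2` per n08-w3's
`…N08HaarCompatibilityInhabited`), then the external inputs AT PRINT'S AVERAGING pinned to the record's classes and minimisers exist (`measurable_avOfPrint`, the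
history-free idiom), and the lane's (α) inputs `RunAlpha` over them — for the lane's step series `𝔖` and (α) data `𝔄` — at every member of `Family L c⋆.eps0`, with
`γ₀ ≤ e^{1−p₀}`, `0 < γ₀p(γ₀) ≤ εbg`, give **`Node00.PrintedUV3V N L`**.  The two hypotheses (E6′, the (α) inputs) are exactly N08's located residuals; nothing else
is owed at this slot. [cite: Balaban1985UV3, Thm 1 p.257 + Thm 2 p.272; Balaban1985Averaging, (10) + (15) p.19] -/
theorem printedUV3V_of_E6'_of_runAlpha_of_ceiling (𝔊 : GroupModel (SU N)) (𝔠 : Primitives.AlphaConsts L 𝔊.N) (εbg : ℝ) (hpos : 0 < εbg)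
    (hE6 : ∀ (S : Scales L) (j : ℕ), (fieldMeasure S.P j (SU N)).map (avOfPrint N S j).avg = fieldMeasure S.P (j + 1) (SU N))
    (hγ : 𝔠.gamma0 ≤ Real.exp (1 - 𝔠.lane.F.p₀)) (hε : 𝔠.gamma0 * B10.pFun 𝔠.lane.F.b₀ 𝔠.lane.F.p₀ 𝔠.gamma0 ≤ εbg) :
    ∃ X : ∀ S : Scales L, ExternalInputs S (SU N), (∀ S, (X S).av = avOfPrint N S) ∧
      ∀ (𝔖 : ∀ (S : Scales L) (k : ℕ), StepSeries S (SU N) ↥(lieC 𝔊) (nblkOf S 𝔠.lane.carrier k) k)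
        (𝔄 : ∀ S : Scales L, AlphaData 𝔊 𝔠 (X S) (𝔖 S)),
        (∀ S : Family L (eps0Of 𝔠.gamma0), RunAlpha 𝔊 𝔠 (X S.1) (𝔖 S.1) (𝔄 S.1)) → Node00.PrintedUV3V N L := by
  refine ⟨fun S =>
    { av := avOfPrint N S
      av_meas := fun j => B10Eq2HaarCompatibility.measurable_avOfPrint N S j
      av_map := fun j => hE6 S j
      reg := fun k => bgReg3 N S k εbg
      Uk := fun k V => UkA N (avOfPrint N) S (k + 1) εbg V
      UkH := fun k _ V => Carriers.ukAll (fun k V => UkA N (avOfPrint N) S (k + 1) εbg V) k V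
      UkH_triv := fun _ _ => rfl }, fun _ => rfl, fun 𝔖 𝔄 R => ?_⟩
  exact printedUV3V_at_record_of_runAlpha_of_ceiling (𝔄 := 𝔄) (fun _ => rfl) hpos (fun _ _ _ => rfl) hγ hε R

end TwoResiduals

/-! ## §5 (v1.1, APPEND-ONLY) The same conclusions WITHOUT the regime condition on the lane's threshold `γ₀`: the window from the constants alone

v1.1 (same seat, 2026-08-28).  §1–§4 are byte-identical.  WHY: §1–§3's binder `hγ : 𝔠.gamma0 ≤ e^{1−p₀}` is a condition on the lane's DEFINED threshold
`γ₀ = min(γ₂₈, γ₄₆, γ_OO, γ₇₁)` (`Primitives.AlphaConsts.gamma0`) — plausible («for g₀ sufficiently small», p. 259 L1) but not a tree theorem.  File 1 §3's CRUDE bound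
`ε₁(0) = g₀p(g₀) ≤ b₀p₀^{p₀}e^{1−p₀}` holds at EVERY coupling `g₀ ≤ 1` (`…LevelZero.eps1OfPrint_zero_le`), so the single condition `b₀p₀^{p₀}e^{1−p₀} ≤ εbg` on the FREE class
radius `εbg` gives the window at every lattice approximation — no condition on `γ₀`.  Cell rule A6: every remaining displayed binder is either free data (`εbg`), the
(α) inputs, `AvgAdmissible₃`, or E6′. -/
section FromConsts

/-- **The window from the constants alone**: `b₀p₀^{p₀}e^{1−p₀} ≤ εbg` ⇒ `ε₁(0)(S) ≤ εbg` at EVERY lattice approximation (`g₀ ≤ 1` along every run).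
[cite: Balaban1985UV3, (7) p.257 + p.256 L15–18] -/
theorem window_of_famConsts (hε : 𝔠.lane.F.b₀ * (𝔠.lane.F.p₀ ^ 𝔠.lane.F.p₀ * Real.exp (1 - 𝔠.lane.F.p₀)) ≤ εbg) (E : Scales L → ℝ) (S : Scales L) :
    eps1OfPrint ({ eps0 := eps0Of 𝔠.gamma0, E := E, b₀ := 𝔠.lane.F.b₀, p₀ := 𝔠.lane.F.p₀, εbg := εbg } : Consts L) S 0 ≤ εbg ∨ 2 < εbg :=
  Or.inl ((eps1OfPrint_zero_le ({ eps0 := eps0Of 𝔠.gamma0, E := E, b₀ := 𝔠.lane.F.b₀, p₀ := 𝔠.lane.F.p₀, εbg := εbg } : Consts L)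
    𝔠.lane.F.b₀_pos.le (by linarith [𝔠.lane.F.two_lt_p₀]) S).trans hε)

/-- Such a class radius is positive (`b₀ > 0`, `p₀ > 0`). [cite: Balaban1985UV3, (7) p.257 (bookkeeping)] -/
theorem pos_of_famConsts (hε : 𝔠.lane.F.b₀ * (𝔠.lane.F.p₀ ^ 𝔠.lane.F.p₀ * Real.exp (1 - 𝔠.lane.F.p₀)) ≤ εbg) : 0 < εbg := by
  have hp : 0 < 𝔠.lane.F.p₀ := by linarith [𝔠.lane.F.two_lt_p₀]
  have h1 : 0 < 𝔠.lane.F.b₀ * (𝔠.lane.F.p₀ ^ 𝔠.lane.F.p₀ * Real.exp (1 - 𝔠.lane.F.p₀)) :=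
    mul_pos 𝔠.lane.F.b₀_pos (mul_pos (Real.rpow_pos_of_pos hp _) (Real.exp_pos _))
  linarith

/-- ★★ **THE RECORD'S PER-RUN DATUM FROM THE (α) INPUTS, `b₀p₀^{p₀}e^{1−p₀} ≤ εbg`** (one member of the `≤`-family; no condition on `γ₀`).
[cite: Balaban1985UV3, Thm 2 p.272 + (7) p.257] -/
theorem repr41_47G_at_record_of_runAlpha_of_consts
    (hUk : ∀ (S : Scales L) k (V : GaugeField S.P (k + 1) (SU N)), (X S).Uk k V = UkA N (fun S => (X S).av) S (k + 1) εbg V)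
    (hε : 𝔠.lane.F.b₀ * (𝔠.lane.F.p₀ ^ 𝔠.lane.F.p₀ * Real.exp (1 - 𝔠.lane.F.p₀)) ≤ εbg)
    {S : Scales L} (hle : S.g ^ 2 * S.ε₀ ≤ (min 𝔠.gamma0 1) ^ 2) (R : RunAlpha 𝔊 𝔠 (X S) (𝔖 S) (𝔄 S)) (k : ℕ) (hk : k ≤ S.K) :
    Repr41_47G N (runObjects₀A N (fun S => (X S).av) (fun S j => (Carriers.run3 ((inputOf 𝔠.lane (X S) (𝔖 S)).toRunInput fun _ => True)).T j)
        (Backgrounds.ofAvg N L fun S => (X S).av))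
      { eps0 := eps0Of 𝔠.gamma0, E := fun S => B10.Ek (inputOf 𝔠.lane (X S) (𝔖 S)).Estep S.K 0,
        b₀ := 𝔠.lane.F.b₀, p₀ := 𝔠.lane.F.p₀, εbg := εbg } S k :=
  repr41_47G_at_record_of_runAlpha_of_window (𝔄 := 𝔄) hUk hle R (window_of_famConsts hε _ S) k hk

/-- ★★ **THE RECORD'S Thm-2 CONJUNCT FROM THE (α) INPUTS ON THE FAMILY, `b₀p₀^{p₀}e^{1−p₀} ≤ εbg`.** [cite: Balaban1985UV3, Thm 2 p.272 + p.256 L15–18] -/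
theorem thm2Printed_at_record_of_runAlpha_of_consts
    (hUk : ∀ (S : Scales L) k (V : GaugeField S.P (k + 1) (SU N)), (X S).Uk k V = UkA N (fun S => (X S).av) S (k + 1) εbg V)
    (hε : 𝔠.lane.F.b₀ * (𝔠.lane.F.p₀ ^ 𝔠.lane.F.p₀ * Real.exp (1 - 𝔠.lane.F.p₀)) ≤ εbg)
    (R : ∀ S : Family L (eps0Of 𝔠.gamma0), RunAlpha 𝔊 𝔠 (X S.1) (𝔖 S.1) (𝔄 S.1)) :
    B10.Thm2Printed (runsAtG N (runObjects₀A N (fun S => (X S).av)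
        (fun S j => (Carriers.run3 ((inputOf 𝔠.lane (X S) (𝔖 S)).toRunInput fun _ => True)).T j) (Backgrounds.ofAvg N L fun S => (X S).av))
      { eps0 := eps0Of 𝔠.gamma0, E := fun S => B10.Ek (inputOf 𝔠.lane (X S) (𝔖 S)).Estep S.K 0,
        b₀ := 𝔠.lane.F.b₀, p₀ := 𝔠.lane.F.p₀, εbg := εbg }) := by
  intro S k hk
  exact repr41_47G_at_record_of_runAlpha_of_consts (𝔄 := 𝔄) hUk hε (le_of_eps0Of S.1 S.2) (R S) k hk

/-- ★★★ **THE PRINTED PAIR `PrintedUV3G` AT THE RECORD'S BINDERS FROM THE (α) INPUTS, `b₀p₀^{p₀}e^{1−p₀} ≤ εbg`** (no condition on `γ₀`).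
[cite: Balaban1985UV3, Thm 1 p.257 + Thm 2 p.272 + pp.256–274] -/
theorem printedUV3G_at_record_of_runAlpha_of_consts
    (hUk : ∀ (S : Scales L) k (V : GaugeField S.P (k + 1) (SU N)), (X S).Uk k V = UkA N (fun S => (X S).av) S (k + 1) εbg V)
    (hε : 𝔠.lane.F.b₀ * (𝔠.lane.F.p₀ ^ 𝔠.lane.F.p₀ * Real.exp (1 - 𝔠.lane.F.p₀)) ≤ εbg)
    (R : ∀ S : Family L (eps0Of 𝔠.gamma0), RunAlpha 𝔊 𝔠 (X S.1) (𝔖 S.1) (𝔄 S.1)) :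
    PrintedUV3G N L (runObjects₀A N (fun S => (X S).av)
        (fun S j => (Carriers.run3 ((inputOf 𝔠.lane (X S) (𝔖 S)).toRunInput fun _ => True)).T j) (Backgrounds.ofAvg N L fun S => (X S).av)) :=
  printedUV3G_of_analyticLeaves_tower3_of_window (fun S => inputOf 𝔠.lane (X S) (𝔖 S))
    { eps0 := eps0Of 𝔠.gamma0, E := fun S => B10.Ek (inputOf 𝔠.lane (X S) (𝔖 S)).Estep S.K 0,
      b₀ := 𝔠.lane.F.b₀, p₀ := 𝔠.lane.F.p₀, εbg := εbg }
    (consts_adm_of_pos 𝔠 (pos_of_famConsts hε) _) (fun _ _ => rfl) (fun S k V => hUk S k V) (fun _ => rfl)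
    (fun S => window_of_famConsts hε _ S.1) 𝔠.lane.normalised
    (fun S => usesConsts_inputOf 𝔠.lane (X S.1) (𝔖 S.1) fun _ => True)
    (fun S => analyticLeavesOf (runResiduals_of_alpha_le (le_of_eps0Of S.1 S.2) (R S)))

/-- ★★★ **THE PRIMED SLOT `Node00.PrintedUV3V' N L` FROM THE (α) INPUTS along an admissible averaging, `b₀p₀^{p₀}e^{1−p₀} ≤ εbg`** (no condition on `γ₀`).
[cite: Balaban1985UV3, Thm 1 p.257 + Thm 2 p.272; Balaban1985Averaging, (14)–(15) p.19] -/
theorem printedUV3V'_at_record_of_runAlpha_of_consts (h𝔞 : Node00.AvgAdmissible₃ N fun S => (X S).av)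
    (hUk : ∀ (S : Scales L) k (V : GaugeField S.P (k + 1) (SU N)), (X S).Uk k V = UkA N (fun S => (X S).av) S (k + 1) εbg V)
    (hε : 𝔠.lane.F.b₀ * (𝔠.lane.F.p₀ ^ 𝔠.lane.F.p₀ * Real.exp (1 - 𝔠.lane.F.p₀)) ≤ εbg)
    (R : ∀ S : Family L (eps0Of 𝔠.gamma0), RunAlpha 𝔊 𝔠 (X S.1) (𝔖 S.1) (𝔄 S.1)) : Node00.PrintedUV3V' N L :=
  ⟨fun S => (X S).av, h𝔞, fun S j => (Carriers.run3 ((inputOf 𝔠.lane (X S) (𝔖 S)).toRunInput fun _ => True)).T j,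
    printedUV3G_at_record_of_runAlpha_of_consts (𝔄 := 𝔄) hUk hε R⟩

/-- ★★ **… and the SLOT OF RECORD `Node00.PrintedUV3V N L` when the lane's external inputs average by print's own (15)** (`(X S).av = avOfPrint N S`, the E6′ binder),
`b₀p₀^{p₀}e^{1−p₀} ≤ εbg` (no condition on `γ₀`). [cite: Balaban1985UV3, Thm 1 p.257 + Thm 2 p.272; Balaban1985Averaging, (15) p.19] -/
theorem printedUV3V_at_record_of_runAlpha_of_consts (hav : ∀ S, (X S).av = avOfPrint N S)
    (hUk : ∀ (S : Scales L) k (V : GaugeField S.P (k + 1) (SU N)), (X S).Uk k V = UkA N (fun S => (X S).av) S (k + 1) εbg V)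
    (hε : 𝔠.lane.F.b₀ * (𝔠.lane.F.p₀ ^ 𝔠.lane.F.p₀ * Real.exp (1 - 𝔠.lane.F.p₀)) ≤ εbg)
    (R : ∀ S : Family L (eps0Of 𝔠.gamma0), RunAlpha 𝔊 𝔠 (X S.1) (𝔖 S.1) (𝔄 S.1)) : Node00.PrintedUV3V N L :=
  printedUV3V_of_analyticLeaves_tower3_of_window (fun S => inputOf 𝔠.lane (X S) (𝔖 S)) hav
    { eps0 := eps0Of 𝔠.gamma0, E := fun S => B10.Ek (inputOf 𝔠.lane (X S) (𝔖 S)).Estep S.K 0,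
      b₀ := 𝔠.lane.F.b₀, p₀ := 𝔠.lane.F.p₀, εbg := εbg }
    (consts_adm_of_pos 𝔠 (pos_of_famConsts hε) _) (fun _ _ => rfl) (fun S k V => hUk S k V) (fun _ => rfl)
    (fun S => window_of_famConsts hε _ S.1) 𝔠.lane.normalised
    (fun S => usesConsts_inputOf 𝔠.lane (X S.1) (𝔖 S.1) fun _ => True)
    (fun S => analyticLeavesOf (runResiduals_of_alpha_le (le_of_eps0Of S.1 S.2) (R S)))

variable (N L) in
/-- ★★★ **THE SLOT OF RECORD FROM THE TWO NAMED RESIDUALS, `b₀p₀^{p₀}e^{1−p₀} ≤ εbg`** (no condition on `γ₀`): E6′ + the (α) inputs at the print-averaging external inputs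
pinned to the record ⇒ `Node00.PrintedUV3V N L`. [cite: Balaban1985UV3, Thm 1 p.257 + Thm 2 p.272; Balaban1985Averaging, (10) + (15) p.19] -/
theorem printedUV3V_of_E6'_of_runAlpha_of_consts (𝔊 : GroupModel (SU N)) (𝔠 : Primitives.AlphaConsts L 𝔊.N) (εbg : ℝ)
    (hε : 𝔠.lane.F.b₀ * (𝔠.lane.F.p₀ ^ 𝔠.lane.F.p₀ * Real.exp (1 - 𝔠.lane.F.p₀)) ≤ εbg)
    (hE6 : ∀ (S : Scales L) (j : ℕ), (fieldMeasure S.P j (SU N)).map (avOfPrint N S j).avg = fieldMeasure S.P (j + 1) (SU N)) :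
    ∃ X : ∀ S : Scales L, ExternalInputs S (SU N), (∀ S, (X S).av = avOfPrint N S) ∧
      ∀ (𝔖 : ∀ (S : Scales L) (k : ℕ), StepSeries S (SU N) ↥(lieC 𝔊) (nblkOf S 𝔠.lane.carrier k) k)
        (𝔄 : ∀ S : Scales L, AlphaData 𝔊 𝔠 (X S) (𝔖 S)),
        (∀ S : Family L (eps0Of 𝔠.gamma0), RunAlpha 𝔊 𝔠 (X S.1) (𝔖 S.1) (𝔄 S.1)) → Node00.PrintedUV3V N L := by
  refine ⟨fun S =>
    { av := avOfPrint N S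
      av_meas := fun j => B10Eq2HaarCompatibility.measurable_avOfPrint N S j
      av_map := fun j => hE6 S j
      reg := fun k => bgReg3 N S k εbg
      Uk := fun k V => UkA N (avOfPrint N) S (k + 1) εbg V
      UkH := fun k _ V => Carriers.ukAll (fun k V => UkA N (avOfPrint N) S (k + 1) εbg V) k V
      UkH_triv := fun _ _ => rfl }, fun _ => rfl, fun 𝔖 𝔄 R => ?_⟩
  exact printedUV3V_at_record_of_runAlpha_of_consts (𝔄 := 𝔄) (fun _ => rfl) (fun _ _ _ => rfl) hε R

end FromConsts

end Summit.QuantumFields.YangMills.BalabanUVNodes.N08Thm2AtRecordFromAlpha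

end
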